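import Mathlib
import Summits.AtomisticToContinuum.Crystallization.Theses.PhononSlackCertificates
import Summits.AtomisticToContinuum.Crystallization.Theorems.PhononSlackCertificatesNearFarGlueRHoles
import Summits.AtomisticToContinuum.Crystallization.Theorems.PhononSlackCertificatesNearFarGlueRLooseExhaustion
import Summits.AtomisticToContinuum.Crystallization.Theorems.NearFarGlueR.Negative.GlueToolkit
import Literature.MathematicalPhysics.StatisticalMechanics.LennardJonesClusters

/-!
# Crux `PhononSlackCertificates.NearFarGlueR` (stmt-AtomisticToContinuum-14970), line `Sketch`:
the FILL step — adding a particle at a deep hole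

Continuation lead c4, part 3a (toward the registered sub-goal `stub_coreReduction`).  The second
monotone operation on a finite configuration, dual to c3's strip: FILL a deep hole `p` (a point at
distance `≥ 3/10` from every particle at which a test particle would bind with
`W_p(x) = Σ_i V(|p − x_i|) ≤ −98309653/125000000 − g`).  Proved here:

* `fill_sep`: the filled configuration `x ⊕ p` is again `3/10`-separated;
* `fill_energy`: the excess drops by `g` — `[𝓔(x ⊕ p) − (N+1)·e*] + g ≤ 𝓔(x) − N·e*` (two-cluster
  identity `interactionEnergy_append` and the certified two-cone floor `e* ≥ −0.7865`,
  `neg_twoCone_le_eStar`);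
* `card_contact_le_fill`: `#T(x) ≤ 5833 + #T(x ⊕ p)` (`T` = bad particles within `21/20` of a
  good one: a contact within `51/20` of `p` is one of `≤ 18³`, any other keeps its
  `3/2`-neighbourhood and its good partner's);
* `card_bad_le_fill`: `#bad(x) ≤ 1332 + #bad(x ⊕ p)`.

Part 3b (`…NearFarGlueRCore`) alternates strips and fills down to a well-bonded, hole-free core;
part 3c (`…NearFarGlueRCoreReduction`) draws the reductions of the residual and of the target.
All `[folklore]`.
-/

noncomputable section

namespace Summit.AtomisticToContinuum.Crystallization.Theorems.PhononSlackCertificatesNearFarGlueR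

open Literature.MathematicalPhysics.StatisticalMechanics
open Literature.Geometry.DiscreteGeometry
open Summit.AtomisticToContinuum.Crystallization.Theses.PhononSlackCertificates
open Summit.AtomisticToContinuum.Crystallization.Theorems.ChargedEnergyGapNegative
  (eStar card_mul_eStar_le)
open Summit.AtomisticToContinuum.Crystallization.Theorems.NearFarGlueRNegative (good_of_good_comp)
open scoped BigOperators

/-! ## §1 The fill step -/

/-- Filling a hole at distance `≥ 3/10` from every particle keeps `3/10`-separation. [folklore] -/
theorem fill_sep {N : ℕ} (x : Fin N → EuclideanSpace ℝ (Fin 3))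
    (hsep : ∀ i j : Fin N, i ≠ j → (3 / 10 : ℝ) ≤ dist (x i) (x j))
    (p : EuclideanSpace ℝ (Fin 3)) (hp : ∀ i : Fin N, (3 / 10 : ℝ) ≤ dist p (x i)) :
    ∀ a b : Fin (N + 1), a ≠ b →
      (3 / 10 : ℝ) ≤ dist (Fin.append x (fun _ : Fin 1 => p) a) (Fin.append x (fun _ : Fin 1 => p) b) := by
  intro a b hab
  induction a using Fin.addCases with
  | left i =>
    induction b using Fin.addCases with
    | left i' =>
      rw [Fin.append_left, Fin.append_left]
      exact hsep i i' fun h => hab (by rw [h])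
    | right l' =>
      rw [Fin.append_left, Fin.append_right, dist_comm]
      exact hp i
  | right l =>
    induction b using Fin.addCases with
    | left i' =>
      rw [Fin.append_right, Fin.append_left]
      exact hp i'
    | right l' =>
      exact absurd (congrArg (Fin.natAdd N) (Subsingleton.elim l l')) hab

/-- **Filling a deep hole lowers the excess by `g`**: if `W_p(x) = Σ_i V(|p − x_i|) ≤
−98309653/125000000 − g` then `[𝓔(x ⊕ p) − (N+1)·e*] + g ≤ 𝓔(x) − N·e*` (two-cluster identity
and the two-cone floor `e* ≥ −98309653/125000000`). [folklore] -/
theorem fill_energy {N : ℕ} (x : Fin N → EuclideanSpace ℝ (Fin 3)) (p : EuclideanSpace ℝ (Fin 3))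
    {g : ℝ} (hdeep : ∑ i, lennardJones (dist p (x i)) ≤ -(98309653 / 125000000 : ℝ) - g) :
    interactionEnergy lennardJones (Fin.append x (fun _ : Fin 1 => p)) -
        ((N : ℝ) + 1) * (⨅ Q : PeriodicConfiguration 3, Q.energyPerParticle lennardJones) + g ≤
      interactionEnergy lennardJones x -
        (N : ℝ) * (⨅ Q : PeriodicConfiguration 3, Q.energyPerParticle lennardJones) := by
  have happ := interactionEnergy_append lennardJones lennardJones_zero x (fun _ : Fin 1 => p)
  have hE1 : interactionEnergy lennardJones (fun _ : Fin 1 => p) ≤ 0 :=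
    interactionEnergy_nonpos_of_sep _ fun l l' hll' => absurd (Subsingleton.elim l l') hll'
  have hcross : ∑ i : Fin N, ∑ j : Fin 1, lennardJones (dist (x i) ((fun _ : Fin 1 => p) j)) =
      ∑ i, lennardJones (dist p (x i)) := by
    refine Finset.sum_congr rfl fun i _ => ?_
    rw [Fin.sum_univ_one, dist_comm]
  have hfloor := neg_twoCone_le_eStar
  rw [hcross] at happ
  rw [happ]
  linarith

/-- **Tight-contact count under a fill**: for a `3/10`-separated `x` and a point `p` at distance
`≥ 3/10` from every particle, `#T(x) ≤ 5833 + #T(x ⊕ p)` — a contact of `x` lies within `51/20` of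
`p` (at most `18³ = 5832` of them), or keeps its whole `3/2`-neighbourhood and that of its good
partner, so it is a contact of `x ⊕ p` (`good_comp_of_good_far`, `good_of_good_comp`). [folklore] -/
theorem card_contact_le_fill {N : ℕ} (x : Fin N → EuclideanSpace ℝ (Fin 3))
    (hsep : ∀ i j : Fin N, i ≠ j → (3 / 10 : ℝ) ≤ dist (x i) (x j))
    (p : EuclideanSpace ℝ (Fin 3)) :
    (Nat.card {j : Fin N // ¬ IsTwoShellGood (1 / 20) (47 / 50) 1 x j ∧
        ∃ i : Fin N, IsTwoShellGood (1 / 20) (47 / 50) 1 x i ∧ dist (x i) (x j) ≤ 21 / 20} : ℝ) ≤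
      5833 + (Nat.card {k : Fin (N + 1) //
        ¬ IsTwoShellGood (1 / 20) (47 / 50) 1 (Fin.append x (fun _ : Fin 1 => p)) k ∧
        ∃ i : Fin (N + 1), IsTwoShellGood (1 / 20) (47 / 50) 1 (Fin.append x (fun _ : Fin 1 => p)) i ∧
          dist (Fin.append x (fun _ : Fin 1 => p) i) (Fin.append x (fun _ : Fin 1 => p) k) ≤
            21 / 20} : ℝ) := by
  classical
  set y := Fin.append x (fun _ : Fin 1 => p) with hy
  set f : Fin N ↪ Fin (N + 1) := ⟨Fin.castAdd 1, Fin.castAdd_injective N 1⟩ with hf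
  have hyf : ∀ j, y (f j) = x j := fun j => by simp [hy, hf]
  have hycomp : y ∘ f = x := funext hyf
  have hrange : ∀ w : Fin (N + 1), w ∉ Set.range f → y w = p := by
    intro w hw
    induction w using Fin.addCases with
    | left i => exact absurd ⟨i, rfl⟩ hw
    | right l => simp [hy]
  set Tx := Finset.univ.filter fun j : Fin N => ¬ IsTwoShellGood (1 / 20) (47 / 50) 1 x j ∧
      ∃ i : Fin N, IsTwoShellGood (1 / 20) (47 / 50) 1 x i ∧ dist (x i) (x j) ≤ 21 / 20 with hTx
  set Ty := Finset.univ.filter fun k : Fin (N + 1) => ¬ IsTwoShellGood (1 / 20) (47 / 50) 1 y k ∧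
      ∃ i : Fin (N + 1), IsTwoShellGood (1 / 20) (47 / 50) 1 y i ∧ dist (y i) (y k) ≤ 21 / 20 with hTy
  set S := Finset.univ.filter fun j : Fin N => dist (x j) p ≤ 51 / 20 with hS
  rw [Nat.card_eq_fintype_card, Fintype.card_subtype, Nat.card_eq_fintype_card, Fintype.card_subtype]
  change ((Tx.card : ℕ) : ℝ) ≤ 5833 + ((Ty.card : ℕ) : ℝ)
  -- the exceptional particles near `p`
  have hSle : (S.card : ℝ) ≤ (2 * (51 / 20) / (3 / 10) + 1) ^ 3 := by
    have hinj : Set.InjOn x S := fun a _ b _ hab => by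
      by_contra hne
      have := hsep a b hne
      rw [hab, dist_self] at this
      exact absurd this (by norm_num)
    rw [← Finset.card_image_of_injOn hinj]
    have h := card_le_of_separated_of_dist_le (S.image x) p (by norm_num : (0 : ℝ) < 3 / 10)
      (by norm_num : (0 : ℝ) ≤ 51 / 20) ?_ ?_
    · rwa [finrank_euclideanSpace_fin] at h
    · intro c hc
      obtain ⟨j, hj, rfl⟩ := Finset.mem_image.1 hc
      exact (Finset.mem_filter.1 hj).2
    · intro c hc c' hc' hne
      obtain ⟨a, -, rfl⟩ := Finset.mem_image.1 hc
      obtain ⟨b, -, rfl⟩ := Finset.mem_image.1 hc'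
      exact hsep a b fun h => hne (h ▸ rfl)
  have h18 : (2 * (51 / 20 : ℝ) / (3 / 10) + 1) ^ 3 = 5832 := by norm_num
  rw [h18] at hSle
  -- contacts far from `p` stay contacts
  have hmap : ∀ j ∈ Tx, j ∉ S → f j ∈ Ty := by
    intro j hj hjS
    obtain ⟨hbad, i, hgood, hd⟩ := (Finset.mem_filter.1 hj).2
    have hfar : 51 / 20 < dist (x j) p := by
      by_contra h
      exact hjS (Finset.mem_filter.2 ⟨Finset.mem_univ _, not_lt.1 h⟩)
    refine Finset.mem_filter.2 ⟨Finset.mem_univ _, fun hg => hbad ?_, f i, ?_, ?_⟩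
    · have h1 := good_comp_of_good_far y f j (fun w hw => ?_) hg
      · rwa [hycomp] at h1
      · rw [hrange w hw, hyf, dist_comm]
        linarith
    · refine good_of_good_comp y f i (fun w hw => ?_) (by rw [hycomp]; exact hgood)
      rw [hrange w hw, hyf]
      have htri := dist_triangle (x j) (x i) p
      rw [dist_comm (x j) (x i)] at htri
      rw [dist_comm]
      linarith
    · rw [hyf, hyf]
      exact hd
  have h1 : Tx.card ≤ S.card + (Tx.filter fun j => j ∉ S).card := by
    have hsplit := Finset.card_filter_add_card_filter_not (s := Tx) (fun j => j ∈ S)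
    have hle : (Tx.filter fun j => j ∈ S).card ≤ S.card :=
      Finset.card_le_card fun j hj => (Finset.mem_filter.1 hj).2
    omega
  have h2 : (Tx.filter fun j => j ∉ S).card ≤ Ty.card := by
    rw [← Finset.card_map f]
    refine Finset.card_le_card fun k hk => ?_
    obtain ⟨j, hj, rfl⟩ := Finset.mem_map.1 hk
    exact hmap j (Finset.mem_filter.1 hj).1 (Finset.mem_filter.1 hj).2
  have h3 : (Tx.card : ℝ) ≤ S.card + Ty.card := by
    have : Tx.card ≤ S.card + Ty.card := by omega
    exact_mod_cast this
  linarith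

/-- **Bad count under a fill**: `#bad(x) ≤ 1332 + #bad(x ⊕ p)` for a `3/10`-separated `x` (a bad
particle of `x` lies within `3/2` of `p` — at most `11³ = 1331` of them — or stays bad).
[folklore] -/
theorem card_bad_le_fill {N : ℕ} (x : Fin N → EuclideanSpace ℝ (Fin 3))
    (hsep : ∀ i j : Fin N, i ≠ j → (3 / 10 : ℝ) ≤ dist (x i) (x j))
    (p : EuclideanSpace ℝ (Fin 3)) :
    (Nat.card {j : Fin N // ¬ IsTwoShellGood (1 / 20) (47 / 50) 1 x j} : ℝ) ≤
      1332 + (Nat.card {k : Fin (N + 1) //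
        ¬ IsTwoShellGood (1 / 20) (47 / 50) 1 (Fin.append x (fun _ : Fin 1 => p)) k} : ℝ) := by
  classical
  set y := Fin.append x (fun _ : Fin 1 => p) with hy
  set f : Fin N ↪ Fin (N + 1) := ⟨Fin.castAdd 1, Fin.castAdd_injective N 1⟩ with hf
  have hyf : ∀ j, y (f j) = x j := fun j => by simp [hy, hf]
  have hycomp : y ∘ f = x := funext hyf
  have hrange : ∀ w : Fin (N + 1), w ∉ Set.range f → y w = p := by
    intro w hw
    induction w using Fin.addCases with
    | left i => exact absurd ⟨i, rfl⟩ hw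
    | right l => simp [hy]
  set Bx := Finset.univ.filter fun j : Fin N => ¬ IsTwoShellGood (1 / 20) (47 / 50) 1 x j with hBx
  set By := Finset.univ.filter fun k : Fin (N + 1) => ¬ IsTwoShellGood (1 / 20) (47 / 50) 1 y k
    with hBy
  set S := Finset.univ.filter fun j : Fin N => dist (x j) p ≤ 3 / 2 with hS
  rw [Nat.card_eq_fintype_card, Fintype.card_subtype, Nat.card_eq_fintype_card, Fintype.card_subtype]
  change ((Bx.card : ℕ) : ℝ) ≤ 1332 + ((By.card : ℕ) : ℝ)
  have hSle : (S.card : ℝ) ≤ (2 * (3 / 2) / (3 / 10) + 1) ^ 3 := by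
    have hinj : Set.InjOn x S := fun a _ b _ hab => by
      by_contra hne
      have := hsep a b hne
      rw [hab, dist_self] at this
      exact absurd this (by norm_num)
    rw [← Finset.card_image_of_injOn hinj]
    have h := card_le_of_separated_of_dist_le (S.image x) p (by norm_num : (0 : ℝ) < 3 / 10)
      (by norm_num : (0 : ℝ) ≤ 3 / 2) ?_ ?_
    · rwa [finrank_euclideanSpace_fin] at h
    · intro c hc
      obtain ⟨j, hj, rfl⟩ := Finset.mem_image.1 hc
      exact (Finset.mem_filter.1 hj).2
    · intro c hc c' hc' hne
      obtain ⟨a, -, rfl⟩ := Finset.mem_image.1 hc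
      obtain ⟨b, -, rfl⟩ := Finset.mem_image.1 hc'
      exact hsep a b fun h => hne (h ▸ rfl)
  have h11 : (2 * (3 / 2 : ℝ) / (3 / 10) + 1) ^ 3 = 1331 := by norm_num
  rw [h11] at hSle
  have hmap : ∀ j ∈ Bx, j ∉ S → f j ∈ By := by
    intro j hj hjS
    have hbad := (Finset.mem_filter.1 hj).2
    have hfar : 3 / 2 < dist (x j) p := by
      by_contra h
      exact hjS (Finset.mem_filter.2 ⟨Finset.mem_univ _, not_lt.1 h⟩)
    refine Finset.mem_filter.2 ⟨Finset.mem_univ _, fun hg => hbad ?_⟩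
    have h1 := good_comp_of_good_far y f j (fun w hw => ?_) hg
    · rwa [hycomp] at h1
    · rw [hrange w hw, hyf, dist_comm]
      exact hfar
  have h1 : Bx.card ≤ S.card + (Bx.filter fun j => j ∉ S).card := by
    have hsplit := Finset.card_filter_add_card_filter_not (s := Bx) (fun j => j ∈ S)
    have hle : (Bx.filter fun j => j ∈ S).card ≤ S.card :=
      Finset.card_le_card fun j hj => (Finset.mem_filter.1 hj).2
    omega
  have h2 : (Bx.filter fun j => j ∉ S).card ≤ By.card := by
    rw [← Finset.card_map f]
    refine Finset.card_le_card fun k hk => ?_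
    obtain ⟨j, hj, rfl⟩ := Finset.mem_map.1 hk
    exact hmap j (Finset.mem_filter.1 hj).1 (Finset.mem_filter.1 hj).2
  have h3 : (Bx.card : ℝ) ≤ S.card + By.card := by
    have : Bx.card ≤ S.card + By.card := by omega
    exact_mod_cast this
  linarith


/-- **Registered sub-goal `stub_fillStep` of the crux item** (skeleton `Lines/Sketch.lean`, c4):
filling a deep hole lowers the excess by `g` — the statement of `fill_energy` in closed form.
[folklore] -/
theorem stub_fillStep :
    ∀ (N : ℕ) (x : Fin N → EuclideanSpace ℝ (Fin 3)) (p : EuclideanSpace ℝ (Fin 3)) (g : ℝ),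
      ∑ i, lennardJones (dist p (x i)) ≤ -(98309653 / 125000000 : ℝ) - g →
      interactionEnergy lennardJones (Fin.append x (fun _ : Fin 1 => p)) -
          ((N : ℝ) + 1) * (⨅ Q : PeriodicConfiguration 3, Q.energyPerParticle lennardJones) + g ≤
        interactionEnergy lennardJones x -
          (N : ℝ) * (⨅ Q : PeriodicConfiguration 3, Q.energyPerParticle lennardJones) :=
  fun _ x p _ hdeep => fill_energy x p hdeep

end Summit.AtomisticToContinuum.Crystallization.Theorems.PhononSlackCertificatesNearFarGlueR

end
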